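/-
Origin: expansion seat `planner-pub-hodgecm-pv11-g7-0`, handover #1 2026-08-18T10:35:43Z (`HOME/pub-hodgecm-pv11-g7/lean/Pv11g7/TorusOccurrence.lean`, md5 a40e578a, 433 lines);
landed by the gen-7 packager in gate run 28 as `HodgeCM/PerL34/TorusOccurrence.lean` (verbatim).
-/
/-
pub-hodgecm cell — DAG-NODE PROVER #11 gen 7 (session planner-pub-hodgecm-pv11-g7-0, unit pub-hodgecm-pv11-g7; the
torus/seesaw/supply lineage pv11 … pv11-g6).  WIP module `Pv11g7.TorusOccurrence`; proposed final place
`HodgeCM/PerL34/TorusOccurrence.lean` (module `HodgeCM.PerL34.TorusOccurrence`).  Imports ONLY the landed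
`HodgeCM.PerL34.WeightProjection` (pv06-g3, run 25; brings `HodgeCM.Automorphic.IsotypicDecomposition` and
`HodgeCM.Automorphic.ThetaCarrierRep`, prl1-g3, run 23), `HodgeCM.PerL34.SeesawTorus` (pv11-g5, run 24) and, for §5 only,
`HodgeCM.PerL34.S4Strength` (pv08-g3, run 23; brings `HodgeCM.PerL34.ArchC`) + Mathlib.
Nothing is posited, nothing is cited: hypothesis-free kernel theorems; no statement of [PerL] enters as a fact.

# "`σ̂`, hence `σ`, contains a non-zero `w`-vector" — the torus dictionary of seam S4 on the end state, KERNEL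

NODE.  Lemma 4.1(c) of [PerL] v5 (node N29; pv06 `HodgeCM/PerL34/ArchC.lean`) ends (tex ll. 522–523, quoted verbatim):
"so $Pv\ne0$: $\hat\sigma$, hence $\sigma$, contains a non-zero vector on which $T_b$ acts by $w_b$."  In the typed
seam-S4 records — pv06 `ArchCDatum`, pv12-g2 `Fock.FockArchBridge`, pv12-g4 `FockAnalyticBridge`, pv12-g7's
`PrintedAnalyticSide` — the step "`σ̂` has a non-zero joint `w`-eigenvector of the chart's torus ⟹ `D.wOccurs i`" is the
LAST field

  `wOccurs_of_eigenvector : ∀ i, (∃ y ∈ C.hatσ i, y ≠ 0 ∧ ∀ t : Tg, C.R (ιT t) y = w t • y) → D.wOccurs i`,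

labelled [DEFINITIONAL] ("the meaning of the bare frozen predicate `TorusData.wOccurs`"); pv08-g3's strength test
(`S4Strength.lean`) locates the whole torus-side content of the S4 binder in exactly this field ("carries exactly the
torus DICTIONARY").  On prl1's END STATE (`ThetaCarrierRep`, `GodementEndState`, `AdelicTorusCompactInput`) the predicate
is no longer bare: `σ̂_c := closure (RepDecomp.isotypic C.R c)` (`RepCoreCarrier.toCoreCarrier_hatσC`) and

  `D.wOccurs c := RepDecomp.WOccurs C.R D.torus D.w c := ∃ V : Members R c, V ⊓ E_w ≠ ⊥`

("some IRREDUCIBLE closed invariant subspace of the class `c` meets the joint eigenspace `E_w`",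
`IsotypicDecomposition.lean` §6, `ThetaCarrierRep.lean` :193), with `D.torus := jT ∘ toAdeles : SeesawArchTorus L → U(W)(𝔸)`
and `D.w := SeesawArchTorus.weight L m₁ m₂` (`AdelicTorusCompactInput.lean` :137–139, :188–192).  For these DEFINED
objects the field is a genuine lemma of unitary representation theory — PerL's "hence σ" — and this file PROVES it:

§1 `RepDecomp.starProjection_mem_Ew` — the orthogonal projection onto a closed `R`-invariant subspace maps `E_w` into
   `E_w` (it commutes with `R`, prl1-g3 `Invariant.starProjection_commute`);
   **`RepDecomp.WOccurs.of_mem_closure_isotypic`** — `R` unitary, `y ∈ closure (isotypic R c)`, `y ≠ 0`, `y ∈ E_w`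
   ⟹ `WOccurs R ι w c`.  Proof: if every member `V` of the class had `V ⊓ E_w = ⊥`, the projections `P_V y ∈ V ⊓ E_w`
   would all vanish, so `y ⊥ V` for every member, `y ⊥ ⨆ V = isotypic R c`, hence `y ⊥` its closure `∋ y`, so `y = 0`.
   (The converse direction, `WOccurs ⟹` a `w`-vector in every closed invariant `M` meeting `σ̂_c`, is prl1-g3's
   `RepDecomp.exists_wvector` = AX9 at `w`.)
§2 **`RepTorusCarrier.wOccurs_of_eigenvector`** — the S4 field in its LITERAL premise shape for prl1's representation-
   theoretic torus carrier `D` over a core `C` with `C.R` unitary, for ANY reparametrisation `e : Tg → D.Tι` of the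
   torus that is SURJECTIVE, with `ιT := D.torus ∘ e`, `w := D.w ∘ e` (pv06-g3 `WeightProjection.Ew_comp_of_surjective`):
   `(∃ y ∈ closure (isotypic C.R c), y ≠ 0 ∧ ∀ t : Tg, C.R (D.torus (e t)) y = D.w (e t) • y) → D.wOccurs c`;
   by `RepCoreCarrier.toCoreCarrier_hatσC`, `RepTorusCarrier.toTorusCarrier_wOccurs`, `TorusCarrier.toTorusData_wOccurs`
   (all `rfl`) this is the field for the reconstructed `IsolationCore` / `TorusData` of the end state —
   spelled out as **`RepTorusCarrier.toTorusData_wOccurs_of_eigenvector`** (premise over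
   `(C.toCoreCarrier.toIsolationCore h).hatσ / .R`, conclusion `(D.toTorusCarrier.toTorusData h hD).wOccurs c`,
   unitarity = the record's own `R_unitary`).  Surjectivity of
   `e` is what keeps the statement honest (pv06 `ArchCDatum` docstring: "a junk instantiation (e.g. `Tg` trivial,
   `w = 1`) would turn `wOccurs_of_eigenvector` into an unrelated strong claim"): for the trivial torus the premise is
   an eigenvector of NOTHING and the lemma does not apply.
§3 The coordinates in which a Fock chart meets §2 on the end state: the chart's torus is `∏_b T_b`, `T_b = U(1) × U(1)`
   over the real places `b` of `L₀` (pv12-g2 `Fock.FockPlaces.Tg := Π b, (loc b).T`; pv12-g6/g7 `T_b := Circle × Circle`),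
   the end state's is `T(L₀ ⊗ ℝ) = SeesawArchTorus L = U(W₁)(L₀⊗ℝ) × U(W₂)(L₀⊗ℝ)`, each factor `≅ ∏_{w∣∞} U(1)` (pv11-g4
   `unitaryLineArchTorusContinuousMulEquiv`; the infinite places `w` of the CM field `L` are in bijection with the real
   places of `L₀ = L⁺`).  **`SeesawArchTorus.placesEquiv L : SeesawArchTorus L ≃ₜ* (InfinitePlace L → Circle × Circle)`**,
   `t ↦ (w ↦ (ι_w(t₁,w), ι_w(t₂,w)))`, and the weight in these coordinates:
   **`SeesawArchTorus.weight_eq_prod_placesEquiv`** `weight L m₁ m₂ t = ∏ w, (placesEquiv L t w).1 ^ m₁ w * (placesEquiv L t w).2 ^ m₂ w`,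
   **`SeesawArchTorus.weight_placesEquiv_symm`** `weight L m₁ m₂ ((placesEquiv L).symm f) = ∏ w, (f w).1 ^ m₁ w * (f w).2 ^ m₂ w`
   (as complex numbers).  This is the line against which a chart's N26 field `w_loc : pl.χ t = (w t)⁻¹` pins the local
   characters: with `w := weight L m₁ m₂ ∘ (placesEquiv L).symm`, the product `∏_b χ_b(t_b)` of the local vacuum ×
   polynomial characters must be `∏_w (t_w)₁^{-m₁ w} (t_w)₂^{-m₂ w}` ([PerL] l. 485–486 "acts by the character
   `−w_b := (−e_b(Ψ₁), −e_b(Ψ₂))`"; adv2-g23 X49: the vacuum characters `vac` of the printed chart are free until so pinned).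
§4 `SeesawArchTorus.wOccurs_of_placesEigenvector` — §1 ∘ §3: for a unitary `R` and a torus `torus : SeesawArchTorus L → G`
   with the typed weight `weight L m₁ m₂` (as in `AdelicTorusCompactInput`: `Tι := SeesawArchTorus L`, `w := weight L m₁ m₂`,
   so the end state's `D.wOccurs c` is `RepDecomp.WOccurs C.R D.torus (weight L m₁ m₂) c` by `rfl`), a non-zero vector of
   `σ̂_c` on which every `f : InfinitePlace L → Circle × Circle` acts through `torus ((placesEquiv L).symm f)` by
   `∏ w, (f w).1 ^ m₁ w * (f w).2 ^ m₂ w` gives `RepDecomp.WOccurs R torus (weight L m₁ m₂) c`.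

§5 **`RepTorusCarrier.nonempty_archCDatum_of_matchedCore`** — §2 read through pv08-g3's split of the S4 record
   (`S4Strength.nonempty_iff_core : Nonempty (ArchCDatum C D P) ↔ ∃ K : ArchCCore C P, ∀ i, K.Eigen i → D.wOccurs i`):
   on the end state, EVERY D-free chart `K : ArchCCore` whose torus matches (`K.ιT = D.torus ∘ e`, `K.w = D.w ∘ e`,
   `e` surjective) is an `ArchCDatum` — the D-dependent conjunct, genuine extra strength over pv08-g3's junk core
   (`isEmpty_archCDatum_smoke`), is DISCHARGED on prl1's end state; what S4 still asks for there is the analytic core.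

Printed inputs: none beyond Mathlib (orthogonal projections `Submodule.starProjection`, `Submodule.iInf_orthogonal`,
`Submodule.orthogonal_orthogonal_eq_closure`).  [PerL] is quoted for NODE LOCATION only (ll. 387–390, 485–486, 522–523).
Axioms: every declaration below has closure [propext, Classical.choice, Quot.sound] (probe `Pv11g7chk/AxiomsTO.lean`).
-/
import Summits.HodgeConjecture.HodgeCM.PerL34.WeightProjection
import Summits.HodgeConjecture.HodgeCM.PerL34.SeesawTorus_3
import Summits.HodgeConjecture.HodgeCM.PerL34.S4Strength_2

set_option autoImplicit false

noncomputable section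

open scoped InnerProductSpace

namespace HodgeCM

/-! ## §1  `σ̂_c ⊓ E_w ∋ y ≠ 0 ⟹ w` occurs in an irreducible member of the class -/

namespace RepDecomp

open HodgeCM.PerL34.Spectral

section OfMemEw

variable {H : Type*} [NormedAddCommGroup H] [InnerProductSpace ℂ H] [CompleteSpace H]
variable {G : Type*} [Group G]
variable {R : G →* (H →L[ℂ] H)} {Tι : Type*} (ι : Tι → G) (w : Tι → ℂ)

omit [CompleteSpace H] in
/-- The orthogonal projection onto a closed `R`-invariant subspace maps the joint eigenspace `E_w` into itself
(it commutes with every `R g`, `Invariant.starProjection_commute`). -/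
theorem starProjection_mem_Ew (hR : IsUnitaryRep R) {V : Submodule ℂ H} [V.HasOrthogonalProjection]
    (hV : Invariant R V) {y : H} (hy : y ∈ Ew R ι w) : V.starProjection y ∈ Ew R ι w := by
  rw [mem_Ew] at hy ⊢
  intro t
  have h : R (ι t) (V.starProjection y) = V.starProjection (R (ι t) y) :=
    congrArg (fun T : H →L[ℂ] H => T y) (hV.starProjection_commute hR (ι t))
  rw [h, hy t, map_smul]

/-- **[PerL] ll. 522–523 "`σ̂`, hence `σ`, contains a non-zero vector on which `T` acts by `w`" — PROVED for the DEFINED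
objects**: if the closed isotypic component `σ̂_c = closure (isotypic R c)` of a unitary `R` contains a non-zero vector
of the joint `w`-eigenspace `E_w` of the family `ι : Tι → G`, then `w` OCCURS in the class `c` in the sense of
`RepDecomp.WOccurs` — some irreducible closed `R`-invariant member `V` of the class has `V ⊓ E_w ≠ ⊥`. -/
theorem WOccurs.of_mem_closure_isotypic (hR : IsUnitaryRep R) {c : IsoClass R} {y : H}
    (hy : y ∈ (isotypic R c).topologicalClosure) (hy0 : y ≠ 0) (hyw : y ∈ Ew R ι w) : WOccurs R ι w c := by
  by_contra hno
  have hbot : ∀ V : Members R c, (V.1.1 : Submodule ℂ H) ⊓ Ew R ι w = ⊥ := by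
    intro V
    by_contra hV
    exact hno ⟨V, hV⟩
  have horth : ∀ V : Members R c, y ∈ (V.1.1 : Submodule ℂ H)ᗮ := by
    intro V
    haveI : CompleteSpace (V.1.1 : Submodule ℂ H) := V.1.2.isClosed.completeSpace_coe
    have hPy : (V.1.1 : Submodule ℂ H).starProjection y ∈ (V.1.1 : Submodule ℂ H) ⊓ Ew R ι w :=
      ⟨Submodule.starProjection_apply_mem _ y, starProjection_mem_Ew ι w hR V.1.2.invariant hyw⟩
    rw [hbot V, Submodule.mem_bot] at hPy
    exact ((V.1.1 : Submodule ℂ H).starProjection_apply_eq_zero_iff).mp hPy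
  have h1 : y ∈ (isotypic R c)ᗮ := by
    rw [isotypic, ← Submodule.iInf_orthogonal, Submodule.mem_iInf]
    exact horth
  have h2 : y ∈ (isotypic R c).topologicalClosureᗮ := by
    rwa [PerL34.WeightProjection.orthogonal_topologicalClosure]
  exact hy0 (inner_self_eq_zero.mp ((Submodule.mem_orthogonal _ y).mp h2 y hy))

/-- The same with the vector taken in the algebraic isotypic component `isotypic R c` itself. -/
theorem WOccurs.of_mem_isotypic (hR : IsUnitaryRep R) {c : IsoClass R} {y : H}
    (hy : y ∈ isotypic R c) (hy0 : y ≠ 0) (hyw : y ∈ Ew R ι w) : WOccurs R ι w c :=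
  WOccurs.of_mem_closure_isotypic ι w hR ((isotypic R c).le_topologicalClosure hy) hy0 hyw

/-- **Characterisation**: for a unitary `R`, `w` occurs in the class `c` iff the CLOSED isotypic component `σ̂_c`
contains a non-zero `w`-vector (`⟸` above; `⟹`: a member is contained in `isotypic R c`). -/
theorem wOccurs_iff_exists_mem_closure_isotypic (hR : IsUnitaryRep R) (c : IsoClass R) :
    WOccurs R ι w c ↔ ∃ y ∈ (isotypic R c).topologicalClosure, y ≠ 0 ∧ y ∈ Ew R ι w := by
  constructor
  · rintro ⟨V, hV⟩
    obtain ⟨y, hy, hy0⟩ := Submodule.exists_mem_ne_zero_of_ne_bot hV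
    exact ⟨y, (isotypic R c).le_topologicalClosure (le_isotypic V hy.1), hy0, hy.2⟩
  · rintro ⟨y, hy, hy0, hyw⟩
    exact WOccurs.of_mem_closure_isotypic ι w hR hy hy0 hyw

omit [CompleteSpace H] in
/-- The eigenvector premise of the S4 field, for a REPARAMETRISED torus `ι ∘ e`, `w ∘ e` with `e` surjective, is
membership in the same joint eigenspace (cf. pv06-g3 `WeightProjection.Ew_comp_of_surjective`). -/
theorem mem_Ew_of_forall_comp {Tg : Type*} (e : Tg → Tι) (he : Function.Surjective e) {y : H}
    (h : ∀ t : Tg, R (ι (e t)) y = w (e t) • y) : y ∈ Ew R ι w := by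
  rw [mem_Ew]
  intro t
  obtain ⟨a, rfl⟩ := he t
  exact h a

end OfMemEw

end RepDecomp

/-! ## §2  The S4 field `wOccurs_of_eigenvector` for prl1's representation-theoretic torus carrier -/

namespace RepTorusCarrier

variable {HH HG CG GG SK SigIdxG : Type}
variable [NormedAddCommGroup HH] [InnerProductSpace ℂ HH] [CompleteSpace HH]
variable [NormedAddCommGroup HG] [InnerProductSpace ℂ HG] [CompleteSpace HG]
variable [NormedAddCommGroup CG] [NormedSpace ℂ CG]
variable [Group GG] [TopologicalSpace GG] [TopologicalSpace SK]
variable {C : RepCoreCarrier HH HG CG GG SK SigIdxG} (D : RepTorusCarrier C)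

/-- **The S4 field `wOccurs_of_eigenvector`, PROVED on the representation-theoretic carriers** ([PerL] ll. 522–523 "hence
σ"): for `C.R` unitary (`RepCoreCarrier.Analytic.R_unitary`) and ANY surjective reparametrisation `e : Tg → D.Tι` of the
torus — chart torus `ιT := D.torus ∘ e`, chart weight `w := D.w ∘ e` — a non-zero vector of the closed isotypic
component `σ̂_c = closure (isotypic C.R c)` (`= C.toCoreCarrier.hatσC c`, `rfl`) on which the chart torus acts by the
chart weight gives `D.wOccurs c` (`= D.toTorusCarrier.wOccurs c = (D.toTorusCarrier.toTorusData _ _).wOccurs c`, `rfl`). -/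
theorem wOccurs_of_eigenvector (hU : PerL34.Spectral.IsUnitaryRep C.R) {Tg : Type*} (e : Tg → D.Tι)
    (he : Function.Surjective e) (c : C.SigIdx)
    (h : ∃ y ∈ (RepDecomp.isotypic C.R c).topologicalClosure, y ≠ 0 ∧
      ∀ t : Tg, C.R (D.torus (e t)) y = D.w (e t) • y) :
    D.wOccurs c := by
  obtain ⟨y, hy, hy0, hyw⟩ := h
  exact RepDecomp.WOccurs.of_mem_closure_isotypic D.torus D.w hU hy hy0
    (RepDecomp.mem_Ew_of_forall_comp D.torus D.w e he hyw)

/-- The same in the literal binder shapes of the reconstructed gen-2 carrier: premise over `C.toCoreCarrier.hatσC c`,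
conclusion `D.toTorusCarrier.wOccurs c`. -/
theorem toTorusCarrier_wOccurs_of_eigenvector (hU : PerL34.Spectral.IsUnitaryRep C.R) {Tg : Type*} (e : Tg → D.Tι)
    (he : Function.Surjective e) (c : C.SigIdx)
    (h : ∃ y ∈ C.toCoreCarrier.hatσC c, y ≠ 0 ∧ ∀ t : Tg, C.toCoreCarrier.R (D.torus (e t)) y = D.w (e t) • y) :
    D.toTorusCarrier.wOccurs c :=
  D.wOccurs_of_eigenvector hU e he c h

/-- **The same in the literal binder shapes of the frozen Prior records** reconstructed from the carriers
(`CoreCarrier.toIsolationCore`, `TorusCarrier.toTorusData`, prl1-g2 `ThetaCarrier.lean`): premise over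
`(C.toCoreCarrier.toIsolationCore h).hatσ c` and `.R`, conclusion `(D.toTorusCarrier.toTorusData h hD).wOccurs c` — i.e.
the field `ArchCDatum.wOccurs_of_eigenvector` / `FockArchBridge.wOccurs_of_eigenvector` of a chart over the end-state
records with `ιT := D.torus ∘ e`, `w := D.w ∘ e`, DISCHARGED (unitarity is the record's own `R_unitary`). -/
theorem toTorusData_wOccurs_of_eigenvector (h : C.toCoreCarrier.Analytic) (hD : D.toTorusCarrier.Analytic)
    {Tg : Type*} (e : Tg → D.Tι) (he : Function.Surjective e) (c : C.SigIdx)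
    (hy : ∃ y ∈ (C.toCoreCarrier.toIsolationCore h).hatσ c, y ≠ 0 ∧
      ∀ t : Tg, (C.toCoreCarrier.toIsolationCore h).R (D.torus (e t)) y = D.w (e t) • y) :
    (D.toTorusCarrier.toTorusData h hD).wOccurs c :=
  D.wOccurs_of_eigenvector h.R_unitary e he c hy

/-- Without reparametrisation (`e := id`). -/
theorem wOccurs_of_eigenvector_id (hU : PerL34.Spectral.IsUnitaryRep C.R) (c : C.SigIdx)
    (h : ∃ y ∈ (RepDecomp.isotypic C.R c).topologicalClosure, y ≠ 0 ∧ ∀ t : D.Tι, C.R (D.torus t) y = D.w t • y) :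
    D.wOccurs c :=
  D.wOccurs_of_eigenvector hU id Function.surjective_id c h

end RepTorusCarrier

/-! ## §5  The S4 binder ON THE END STATE: pv08-g3's located excess is discharged for torus-matched charts

pv08-g3 (`S4Strength.lean`, run 23) split the S4 instantiation record as
`Nonempty (ArchCDatum C D P) ↔ ∃ K : ArchCCore C P, ∀ i, K.Eigen i → D.wOccurs i` (`nonempty_iff_core`) and showed
the right conjunct is GENUINE extra strength over a junk core (`isEmpty_archCDatum_smoke`).  On prl1's end state the
conjunct `K.Eigen i → D.wOccurs i` is §2 for every D-free chart `K` whose torus is a surjective reparametrisation of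
the end state's torus with the end state's weight: such a chart IS an `ArchCDatum`.  What remains of S4 on the end
state is therefore exactly the D-free analytic core `ArchCCore` with matched torus (the Fock lane, pv12). -/

namespace RepTorusCarrier

open HodgeCM.Prior.Perl34File HodgeCM.Prior.Perl34File.Perl34 HodgeCM.PerL34.ArchC

variable {HH HG CG GG SK SigIdxG : Type}
variable [NormedAddCommGroup HH] [InnerProductSpace ℂ HH] [CompleteSpace HH]
variable [NormedAddCommGroup HG] [InnerProductSpace ℂ HG] [CompleteSpace HG]
variable [NormedAddCommGroup CG] [NormedSpace ℂ CG]
variable [Group GG] [TopologicalSpace GG] [TopologicalSpace SK]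
variable {C : RepCoreCarrier HH HG CG GG SK SigIdxG} (D : RepTorusCarrier C)

/-- A D-free chart over the end state's reconstructed `IsolationCore` whose torus MATCHES the end state's
(`K.ιT = D.torus ∘ e`, `K.w = D.w ∘ e`, `e` surjective) has `K.Eigen i → wOccurs i` for every `i` (§2). -/
theorem eigen_imp_wOccurs_of_matched (h : C.toCoreCarrier.Analytic) (hD : D.toTorusCarrier.Analytic)
    {P : C4a.PointedCore (C.toCoreCarrier.toIsolationCore h)}
    (K : ArchCCore (C.toCoreCarrier.toIsolationCore h) P) (e : K.Tg → D.Tι) (he : Function.Surjective e)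
    (hι : ∀ t, K.ιT t = D.torus (e t)) (hw : ∀ t, K.w t = D.w (e t)) (i : C.SigIdx) (hK : K.Eigen i) :
    (D.toTorusCarrier.toTorusData h hD).wOccurs i := by
  obtain ⟨y, hy, hy0, hyt⟩ := hK
  exact D.toTorusData_wOccurs_of_eigenvector h hD e he i
    ⟨y, hy, hy0, fun t => by rw [← hι, ← hw]; exact hyt t⟩

/-- **The S4 binder is inhabited on the end state by ANY torus-matched D-free chart**: pv08-g3's D-dependent
conjunct of `nonempty_iff_core` is discharged, so on prl1's end state `Nonempty (ArchCDatum …)` asks for nothing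
beyond the analytic core `ArchCCore` with the intended torus and weight. -/
theorem nonempty_archCDatum_of_matchedCore (h : C.toCoreCarrier.Analytic) (hD : D.toTorusCarrier.Analytic)
    {P : C4a.PointedCore (C.toCoreCarrier.toIsolationCore h)}
    (K : ArchCCore (C.toCoreCarrier.toIsolationCore h) P) (e : K.Tg → D.Tι) (he : Function.Surjective e)
    (hι : ∀ t, K.ιT t = D.torus (e t)) (hw : ∀ t, K.w t = D.w (e t)) :
    Nonempty (ArchCDatum (C.toCoreCarrier.toIsolationCore h) (D.toTorusCarrier.toTorusData h hD) P) :=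
  ⟨K.toDatum _ (D.eigen_imp_wOccurs_of_matched h hD K e he hι hw)⟩

/-- The same with the existential over matched charts as the hypothesis (the end-state reading of
`nonempty_iff_core`'s right-hand side). -/
theorem nonempty_archCDatum_of_exists_matchedCore (h : C.toCoreCarrier.Analytic) (hD : D.toTorusCarrier.Analytic)
    {P : C4a.PointedCore (C.toCoreCarrier.toIsolationCore h)}
    (hK : ∃ K : ArchCCore (C.toCoreCarrier.toIsolationCore h) P, ∃ e : K.Tg → D.Tι,
      Function.Surjective e ∧ (∀ t, K.ιT t = D.torus (e t)) ∧ ∀ t, K.w t = D.w (e t)) :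
    Nonempty (ArchCDatum (C.toCoreCarrier.toIsolationCore h) (D.toTorusCarrier.toTorusData h hD) P) := by
  obtain ⟨K, e, he, hι, hw⟩ := hK
  exact D.nonempty_archCDatum_of_matchedCore h hD K e he hι hw

end RepTorusCarrier

end HodgeCM

/-! ## §3  Place coordinates on `T(L₀ ⊗ ℝ)` and the typed weight in them -/

namespace NumberField

namespace SeesawArchTorus

open NumberField.InfinitePlace

variable (L : Type) [Field L] [NumberField L] [IsCMField L]

/-- The place coordinates `t ↦ (w ↦ (ι_w(t₁,w), ι_w(t₂,w)))` as a monoid hom. -/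
def placeCoords : SeesawArchTorus L →* (InfinitePlace L → Circle × Circle) where
  toFun t w := (archPlaceChar L w (fst L t), archPlaceChar L w (snd L t))
  map_one' := by
    funext w
    simp only [map_one, Pi.one_apply, Prod.mk_one_one]
  map_mul' s t := by
    funext w
    simp only [map_mul, Pi.mul_apply, Prod.mk_mul_mk]

variable {L} in
/-- (Ported verbatim from the HodgeCMPerL package; no docstring in the source.) -/
@[simp] theorem placeCoords_apply (t : SeesawArchTorus L) (w : InfinitePlace L) :
    placeCoords L t w = (archPlaceChar L w (fst L t), archPlaceChar L w (snd L t)) := rfl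

variable {L} in
/-- (Ported verbatim from the HodgeCMPerL package; no docstring in the source.) -/
theorem placeCoords_mk (t₁ t₂ : unitaryLineArchTorus L) (w : InfinitePlace L) :
    placeCoords L (mk L t₁ t₂) w = (archPlaceChar L w t₁, archPlaceChar L w t₂) := rfl

/-- (Ported verbatim from the HodgeCMPerL package; no docstring in the source.) -/
theorem continuous_placeCoords : Continuous (placeCoords L) :=
  continuous_pi fun w =>
    ((continuous_archPlaceChar L w).comp _root_.continuous_fst).prodMk
      ((continuous_archPlaceChar L w).comp _root_.continuous_snd)

/-- The inverse coordinates: `f ↦ (E⁻¹ (w ↦ (f w).1), E⁻¹ (w ↦ (f w).2))`, `E = unitaryLineArchTorusContinuousMulEquiv L`. -/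
def ofPlaceCoords (f : InfinitePlace L → Circle × Circle) : SeesawArchTorus L :=
  mk L ((unitaryLineArchTorusContinuousMulEquiv L).symm fun w => (f w).1)
    ((unitaryLineArchTorusContinuousMulEquiv L).symm fun w => (f w).2)

variable {L} in
/-- (Ported verbatim from the HodgeCMPerL package; no docstring in the source.) -/
theorem archPlaceChar_symm_apply (g : InfinitePlace L → Circle) (w : InfinitePlace L) :
    archPlaceChar L w ((unitaryLineArchTorusContinuousMulEquiv L).symm g) = g w := by
  have h := congrFun ((unitaryLineArchTorusContinuousMulEquiv L).apply_symm_apply g) w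
  exact h

variable {L} in
/-- (Ported verbatim from the HodgeCMPerL package; no docstring in the source.) -/
theorem placeCoords_ofPlaceCoords (f : InfinitePlace L → Circle × Circle) :
    placeCoords L (ofPlaceCoords L f) = f := by
  funext w
  rw [ofPlaceCoords, placeCoords_mk, archPlaceChar_symm_apply, archPlaceChar_symm_apply]

variable {L} in
/-- (Ported verbatim from the HodgeCMPerL package; no docstring in the source.) -/
theorem ofPlaceCoords_placeCoords (t : SeesawArchTorus L) : ofPlaceCoords L (placeCoords L t) = t := by
  have h1 : (fun w => (placeCoords L t w).1) = unitaryLineArchTorusContinuousMulEquiv L (fst L t) := by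
    funext w; rfl
  have h2 : (fun w => (placeCoords L t w).2) = unitaryLineArchTorusContinuousMulEquiv L (snd L t) := by
    funext w; rfl
  rw [ofPlaceCoords, h1, h2, ContinuousMulEquiv.symm_apply_apply, ContinuousMulEquiv.symm_apply_apply]
  exact mk_fst_snd t

/-- **`T(L₀ ⊗ ℝ) ≅ ∏_{w ∣ ∞} U(1) × U(1)` as topological groups** — the place coordinates of the seesaw archimedean
torus (both factors `U(W_j)(L₀ ⊗ ℝ) ≅ ∏_w U(1)` by pv11-g4's `unitaryLineArchTorusContinuousMulEquiv`). -/
def placesEquiv : SeesawArchTorus L ≃ₜ* (InfinitePlace L → Circle × Circle) :=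
  { (MulEquiv.mk ⟨placeCoords L, ofPlaceCoords L, ofPlaceCoords_placeCoords, placeCoords_ofPlaceCoords⟩
      (placeCoords L).map_mul) with
    continuous_toFun := continuous_placeCoords L
    continuous_invFun := by
      exact Continuous.homeoOfEquivCompactToT2
          (f := ⟨placeCoords L, ofPlaceCoords L, ofPlaceCoords_placeCoords, placeCoords_ofPlaceCoords⟩)
          (continuous_placeCoords L) |>.symm.continuous }

variable {L} in
/-- (Ported verbatim from the HodgeCMPerL package; no docstring in the source.) -/
@[simp] theorem placesEquiv_apply (t : SeesawArchTorus L) : placesEquiv L t = placeCoords L t := rfl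

variable {L} in
/-- (Ported verbatim from the HodgeCMPerL package; no docstring in the source.) -/
@[simp] theorem placesEquiv_symm_apply (f : InfinitePlace L → Circle × Circle) :
    (placesEquiv L).symm f = ofPlaceCoords L f := rfl

variable {L} in
/-- (Ported verbatim from the HodgeCMPerL package; no docstring in the source.) -/
theorem placeCoords_placesEquiv_symm (f : InfinitePlace L → Circle × Circle) :
    placeCoords L ((placesEquiv L).symm f) = f :=
  placeCoords_ofPlaceCoords f

/-- (Ported verbatim from the HodgeCMPerL package; no docstring in the source.) -/
theorem placesEquiv_surjective : Function.Surjective (placesEquiv L) := (placesEquiv L).surjective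

/-- (Ported verbatim from the HodgeCMPerL package; no docstring in the source.) -/
theorem placesEquiv_symm_surjective : Function.Surjective (placesEquiv L).symm := (placesEquiv L).symm.surjective

/-- **The typed weight in place coordinates**: `w_{(m₁,m₂)}(t) = ∏_w ι_w(t₁)^{m₁ w} · ι_w(t₂)^{m₂ w}`. -/
theorem weight_eq_prod_placeCoords (m₁ m₂ : InfinitePlace L → ℤ) (t : SeesawArchTorus L) :
    weight L m₁ m₂ t = ∏ w, (((placeCoords L t w).1 : Circle) : ℂ) ^ (m₁ w) * (((placeCoords L t w).2 : Circle) : ℂ) ^ (m₂ w) := by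
  rw [weight_apply, archWeight_eq_prod, archWeight_eq_prod, ← Finset.prod_mul_distrib]
  rfl

/-- (Ported verbatim from the HodgeCMPerL package; no docstring in the source.) -/
theorem weight_eq_prod_placesEquiv (m₁ m₂ : InfinitePlace L → ℤ) (t : SeesawArchTorus L) :
    weight L m₁ m₂ t = ∏ w, (((placesEquiv L t w).1 : Circle) : ℂ) ^ (m₁ w) * (((placesEquiv L t w).2 : Circle) : ℂ) ^ (m₂ w) :=
  weight_eq_prod_placeCoords L m₁ m₂ t

/-- **The typed weight pulled back to `∏_w U(1) × U(1)`**: `weight L m₁ m₂ ((placesEquiv L)⁻¹ f) = ∏_w (f w)₁^{m₁ w} (f w)₂^{m₂ w}`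
— the per-place character line a Fock chart's `w_loc` must match ([PerL] l. 485–486: `T_b` acts on `φ⁰_b` by `−w_b`). -/
theorem weight_placesEquiv_symm (m₁ m₂ : InfinitePlace L → ℤ) (f : InfinitePlace L → Circle × Circle) :
    weight L m₁ m₂ ((placesEquiv L).symm f) = ∏ w, (((f w).1 : Circle) : ℂ) ^ (m₁ w) * (((f w).2 : Circle) : ℂ) ^ (m₂ w) := by
  rw [weight_eq_prod_placeCoords, placeCoords_placesEquiv_symm]


-- port_pkg: scope closed for this part
end SeesawArchTorus
end NumberField
end
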